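import Summits.Parity.GeneralizedHardyLittlewood.Theorems.FordMaynardSieveConst01651SieveConst01651RectBrackets
import HarnessLib

/-!
# Route `FordMaynardSieveConst01651`, target `SieveConst01651` (stmt-Parity-19185), stub `stub_certValuePos` (R2):
# rectangle brackets on HALF-OPEN grid rectangles

Def-free helper file: the brackets of `…RectBrackets` restated on `[u₀/J,(u₀+S)/J) × [v₀/J,(v₀+T)/J)` (`Ico × Ico`),
the form on which the table lookups bound `Φ₆(1 − y₁ − y₂)` pointwise (`…RectPhiBounds.phiSix_bounds_on_rect`):
`rect_integral_ge_Ico`, `rect_integral_le_Ico` (same proofs; `∫_{[a,b)} dy/y = ∫_a^b dy/y`).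

References: folklore (Hermite–Hadamard), Fubini.
-/

noncomputable section

open MeasureTheory Set intervalIntegral

namespace Summit.Parity.GeneralizedHardyLittlewood.FordMaynardSieveConst01651SieveConst01651

/-- `∫_{[a, b)} dy/y = ∫_a^b dy/y` for `a ≤ b`. [folklore] -/
theorem setIntegral_Ico_inv {a b : ℝ} (hab : a ≤ b) :
    ∫ y in Set.Ico a b, 1 / y = ∫ y in a..b, 1 / y := by
  rw [intervalIntegral.integral_of_le hab, setIntegral_congr_set Ico_ae_eq_Ioc]

/-- `∫_{[a,b)} dy/y ≥ 0` for `0 < a`. [folklore] -/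
theorem inv_integral_Ico_nonneg {a b : ℝ} (ha : 0 < a) : 0 ≤ ∫ y in Set.Ico a b, 1 / y :=
  setIntegral_nonneg measurableSet_Ico fun y hy => by
    have : 0 < y := lt_of_lt_of_le ha hy.1
    positivity

/-- Integrability on a half-open rectangle in the open quadrant. [folklore] -/
theorem integrableOn_rect_Ico {Ψ : ℝ → ℝ} (hΨm : Measurable Ψ) {C : ℝ} (hΨC : ∀ x, |Ψ x| ≤ C)
    {a b c d : ℝ} (ha : 0 < a) (hc : 0 < c) :
    IntegrableOn (fun y : ℝ × ℝ => Ψ (y.1 + y.2) / (y.1 * y.2)) (Set.Ico a b ×ˢ Set.Ico c d)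
      ((volume : Measure ℝ).prod volume) :=
  (integrableOn_rect hΨm hΨC ha hc).mono_set (Set.prod_mono Set.Ico_subset_Icc_self Set.Ico_subset_Icc_self)

/-- **Lower rectangle bracket, half-open form.** [folklore] -/
theorem rect_integral_ge_Ico {Ψ : ℝ → ℝ} (hΨm : Measurable Ψ) {C : ℝ} (hΨC : ∀ x, |Ψ x| ≤ C) {J : ℝ} (hJ : 0 < J)
    {u₀ v₀ S T : ℕ} (hu : 0 < u₀) (hv : 0 < v₀) {L : ℝ} (hL0 : 0 ≤ L)
    (hL : ∀ y ∈ Set.Ico ((u₀ : ℝ) / J) (((u₀ : ℝ) + S) / J) ×ˢ Set.Ico ((v₀ : ℝ) / J) (((v₀ : ℝ) + T) / J),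
      L ≤ Ψ (y.1 + y.2)) :
    L * ((2 : ℝ) * S / (2 * u₀ + S)) * ((2 : ℝ) * T / (2 * v₀ + T)) ≤
      ∫ y in Set.Ico ((u₀ : ℝ) / J) (((u₀ : ℝ) + S) / J) ×ˢ Set.Ico ((v₀ : ℝ) / J) (((v₀ : ℝ) + T) / J),
        Ψ (y.1 + y.2) / (y.1 * y.2) ∂((volume : Measure ℝ).prod volume) := by
  have ha : (0 : ℝ) < (u₀ : ℝ) / J := by positivity
  have hc : (0 : ℝ) < (v₀ : ℝ) / J := by positivity
  have hleS : (u₀ : ℝ) / J ≤ ((u₀ : ℝ) + S) / J := by rw [add_div]; linarith [(by positivity : (0:ℝ) ≤ (S:ℝ) / J)]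
  have hleT : (v₀ : ℝ) / J ≤ ((v₀ : ℝ) + T) / J := by rw [add_div]; linarith [(by positivity : (0:ℝ) ≤ (T:ℝ) / J)]
  set R := Set.Ico ((u₀ : ℝ) / J) (((u₀ : ℝ) + S) / J) ×ˢ Set.Ico ((v₀ : ℝ) / J) (((v₀ : ℝ) + T) / J) with hR
  have hconst : Measurable (fun _ : ℝ => L) := measurable_const
  have hmono : ∫ y in R, (fun _ : ℝ => L) (y.1 + y.2) / (y.1 * y.2) ∂((volume : Measure ℝ).prod volume) ≤
      ∫ y in R, Ψ (y.1 + y.2) / (y.1 * y.2) ∂((volume : Measure ℝ).prod volume) := by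
    refine setIntegral_mono_on (integrableOn_rect_Ico hconst (C := |L|) (fun _ => le_rfl) ha hc)
      (integrableOn_rect_Ico hΨm hΨC ha hc) (measurableSet_Ico.prod measurableSet_Ico) fun y hy => ?_
    have hy1 : 0 < y.1 := lt_of_lt_of_le ha hy.1.1
    have hy2 : 0 < y.2 := lt_of_lt_of_le hc hy.2.1
    exact div_le_div_of_nonneg_right (hL y hy) (mul_pos hy1 hy2).le
  refine le_trans ?_ hmono
  have hfac : ∫ y in R, (fun _ : ℝ => L) (y.1 + y.2) / (y.1 * y.2) ∂((volume : Measure ℝ).prod volume) =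
      L * ((∫ y in Set.Ico ((u₀ : ℝ) / J) (((u₀ : ℝ) + S) / J), 1 / y) *
        ∫ y in Set.Ico ((v₀ : ℝ) / J) (((v₀ : ℝ) + T) / J), 1 / y) := by
    rw [hR, ← setIntegral_prod_mul, ← MeasureTheory.integral_const_mul]
    refine setIntegral_congr_fun (measurableSet_Ico.prod measurableSet_Ico) fun y _ => ?_
    simp only
    ring
  rw [hfac]
  have h1 := inv_integral_grid_ge hJ hu (S := S)
  have h2 := inv_integral_grid_ge hJ hv (S := T)
  rw [setIntegral_Icc_inv hleS, ← setIntegral_Ico_inv hleS] at h1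
  rw [setIntegral_Icc_inv hleT, ← setIntegral_Ico_inv hleT] at h2
  have h1' : (0 : ℝ) ≤ 2 * S / (2 * u₀ + S) := by positivity
  have h2' : (0 : ℝ) ≤ 2 * T / (2 * v₀ + T) := by positivity
  rw [mul_assoc]
  exact mul_le_mul_of_nonneg_left (mul_le_mul h1 h2 h2' (h1'.trans h1)) hL0

/-- **Upper rectangle bracket, half-open form.** [folklore] -/
theorem rect_integral_le_Ico {Ψ : ℝ → ℝ} (hΨm : Measurable Ψ) {C : ℝ} (hΨC : ∀ x, |Ψ x| ≤ C) {J : ℝ} (hJ : 0 < J)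
    {u₀ v₀ S T : ℕ} (hu : 0 < u₀) (hv : 0 < v₀) {U : ℝ} (hU0 : 0 ≤ U)
    (hU : ∀ y ∈ Set.Ico ((u₀ : ℝ) / J) (((u₀ : ℝ) + S) / J) ×ˢ Set.Ico ((v₀ : ℝ) / J) (((v₀ : ℝ) + T) / J),
      Ψ (y.1 + y.2) ≤ U) :
    ∫ y in Set.Ico ((u₀ : ℝ) / J) (((u₀ : ℝ) + S) / J) ×ˢ Set.Ico ((v₀ : ℝ) / J) (((v₀ : ℝ) + T) / J),
        Ψ (y.1 + y.2) / (y.1 * y.2) ∂((volume : Measure ℝ).prod volume) ≤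
      U * ((S : ℝ) * (2 * u₀ + S) / (2 * u₀ * (u₀ + S))) * ((T : ℝ) * (2 * v₀ + T) / (2 * v₀ * (v₀ + T))) := by
  have ha : (0 : ℝ) < (u₀ : ℝ) / J := by positivity
  have hc : (0 : ℝ) < (v₀ : ℝ) / J := by positivity
  have hleS : (u₀ : ℝ) / J ≤ ((u₀ : ℝ) + S) / J := by rw [add_div]; linarith [(by positivity : (0:ℝ) ≤ (S:ℝ) / J)]
  have hleT : (v₀ : ℝ) / J ≤ ((v₀ : ℝ) + T) / J := by rw [add_div]; linarith [(by positivity : (0:ℝ) ≤ (T:ℝ) / J)]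
  set R := Set.Ico ((u₀ : ℝ) / J) (((u₀ : ℝ) + S) / J) ×ˢ Set.Ico ((v₀ : ℝ) / J) (((v₀ : ℝ) + T) / J) with hR
  have hconst : Measurable (fun _ : ℝ => U) := measurable_const
  have hmono : ∫ y in R, Ψ (y.1 + y.2) / (y.1 * y.2) ∂((volume : Measure ℝ).prod volume) ≤
      ∫ y in R, (fun _ : ℝ => U) (y.1 + y.2) / (y.1 * y.2) ∂((volume : Measure ℝ).prod volume) := by
    refine setIntegral_mono_on (integrableOn_rect_Ico hΨm hΨC ha hc)
      (integrableOn_rect_Ico hconst (C := |U|) (fun _ => le_rfl) ha hc) (measurableSet_Ico.prod measurableSet_Ico)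
      fun y hy => ?_
    have hy1 : 0 < y.1 := lt_of_lt_of_le ha hy.1.1
    have hy2 : 0 < y.2 := lt_of_lt_of_le hc hy.2.1
    exact div_le_div_of_nonneg_right (hU y hy) (mul_pos hy1 hy2).le
  refine le_trans hmono ?_
  have hfac : ∫ y in R, (fun _ : ℝ => U) (y.1 + y.2) / (y.1 * y.2) ∂((volume : Measure ℝ).prod volume) =
      U * ((∫ y in Set.Ico ((u₀ : ℝ) / J) (((u₀ : ℝ) + S) / J), 1 / y) *
        ∫ y in Set.Ico ((v₀ : ℝ) / J) (((v₀ : ℝ) + T) / J), 1 / y) := by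
    rw [hR, ← setIntegral_prod_mul, ← MeasureTheory.integral_const_mul]
    refine setIntegral_congr_fun (measurableSet_Ico.prod measurableSet_Ico) fun y _ => ?_
    simp only
    ring
  rw [hfac, mul_assoc]
  have h1 := inv_integral_grid_le hJ hu (S := S)
  have h2 := inv_integral_grid_le hJ hv (S := T)
  rw [setIntegral_Icc_inv hleS, ← setIntegral_Ico_inv hleS] at h1
  rw [setIntegral_Icc_inv hleT, ← setIntegral_Ico_inv hleT] at h2
  have h1' := inv_integral_Ico_nonneg (b := ((u₀ : ℝ) + S) / J) ha
  have h2' := inv_integral_Ico_nonneg (b := ((v₀ : ℝ) + T) / J) hc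
  exact mul_le_mul_of_nonneg_left (mul_le_mul h1 h2 h2' (h1'.trans h1)) hU0

end Summit.Parity.GeneralizedHardyLittlewood.FordMaynardSieveConst01651SieveConst01651

end
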